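import Summits.Ventures.PackingBounds.SphericalCodes.TouchingMutuallyTouchingSpheres
import Summits.Ventures.PackingBounds.Configurations.Dim6Card27
import Summits.Ventures.PackingBounds.Configurations.Dim5Card16
import Summits.Ventures.PackingBounds.Configurations.Dim7Card56

/-!
# Spheres touching `k + 1` mutually touching spheres: the converse construction and exact values in `ℝ⁸`

Framing: lottery ticket; floor = certified bounds/negative ranges. Venture `PackingBounds` (cell `pub-packcert`),
spherical-codes family; companion of `SphericalCodes/TouchingMutuallyTouchingSpheres.lean` (SPLAG Ch. 14 Theorem 1).

The converse of Theorem 1: a code of `M` unit vectors of `ℝⁿ` with pairwise inner products `≤ 1/(k+2)` yields `k + 1`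
mutually touching unit spheres of `ℝⁿ⁺ᵏ` together with `M` further unit spheres, pairwise non-overlapping, each touching all
`k + 1` of them (`exists_touching_of_code`). Construction: in `ℝⁿ × ℝᵏ⁺¹` take the simplex `√2·eᵢ` (second factor) and the
centres `(ρ·x, centroid)` with `ρ² = 2(k+2)/(k+1)`; everything lies in a hyperplane, which is moved to `ℝⁿ⁺ᵏ` by an
inner-product-preserving map (`Config.exists_inner_preserving`). Hence the dictionary is two-sided
(`touching_isGreatest_of_code_isGreatest`), and SPLAG Ch. 14 Example 2 becomes a list of EXACT kernel values in `ℝ⁸`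
from the cell's two-sided code theorems: **exactly `56` / `27` / `16`** non-overlapping unit spheres can touch two / three /
four mutually touching unit spheres of `ℝ⁸` (`E₈` numbers; `Config.Dim7Card56`, `Config.Dim6Card27`, `Config.Dim5Card16`).

## References
* J. H. Conway, N. J. A. Sloane, *Sphere Packings, Lattices and Groups*, 3rd ed., Springer 1999, Ch. 14 Theorem 1 and
  Example 2. [`ConwaySloane1999`]
-/

noncomputable section

open Finset Module
open scoped RealInnerProductSpace

namespace Summit.Ventures.PackingBounds.SphericalCodes

/-! ## Product coordinates `ℝⁿ × ℝᵐ` as `EuclideanSpace ℝ (Fin n ⊕ Fin m)` -/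

/-- The vector of `EuclideanSpace ℝ (ι ⊕ κ)` with components `f` on `ι` and `g` on `κ`. -/
theorem exists_pair_coords (ι κ : Type*) [Fintype ι] [Fintype κ] [DecidableEq ι] [DecidableEq κ] :
    ∃ P : EuclideanSpace ℝ ι → EuclideanSpace ℝ κ → EuclideanSpace ℝ (ι ⊕ κ),
      (∀ f f' g g', inner ℝ (P f g) (P f' g') = inner ℝ f f' + inner ℝ g g') ∧
      (∀ f f' g g', P f g - P f' g' = P (f - f') (g - g')) := by
  refine ⟨fun f g => (WithLp.equiv 2 (ι ⊕ κ → ℝ)).symm (Sum.elim (WithLp.equiv 2 _ f) (WithLp.equiv 2 _ g)),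
    fun f f' g g' => ?_, fun f f' g g' => ?_⟩
  · simp only [EuclideanSpace.inner_eq_star_dotProduct, dotProduct, star_trivial, Pi.star_apply]
    rw [Fintype.sum_sum_type]
    simp
  · apply (WithLp.ofLp_injective (p := 2)).eq_iff.mp
    ext j
    rcases j with i | i <;> simp

/-! ## The converse of SPLAG Ch. 14 Theorem 1 -/

/-- **Converse of SPLAG Ch. 14 Theorem 1.** A code `C` of unit vectors of `ℝⁿ` with pairwise inner products `≤ 1/(k+2)`
yields `k + 1` mutually touching unit spheres of `ℝⁿ⁺ᵏ` (centres `a₀, …, a_k`, `‖aᵢ - aⱼ‖ = 2`) and `C.card` further unit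
spheres with pairwise disjoint interiors (`‖c - c'‖ ≥ 2`) each touching all of them (`‖c - aᵢ‖ = 2`).
[cite: ConwaySloane1999, Ch. 14 Theorem 1] -/
theorem exists_touching_of_code {n k : ℕ} (C : Finset (EuclideanSpace ℝ (Fin n))) (h1 : ∀ x ∈ C, ‖x‖ = 1)
    (h2 : ∀ x ∈ C, ∀ y ∈ C, x ≠ y → inner ℝ x y ≤ 1 / ((k : ℝ) + 2)) :
    ∃ a : Fin (k + 1) → EuclideanSpace ℝ (Fin (n + k)), (∀ i j, i ≠ j → ‖a i - a j‖ = 2) ∧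
      ∃ S : Finset (EuclideanSpace ℝ (Fin (n + k))), S.card = C.card ∧ (∀ c ∈ S, ∀ i, ‖c - a i‖ = 2) ∧
        (∀ c ∈ S, ∀ c' ∈ S, c ≠ c' → 2 ≤ ‖c - c'‖) := by
  classical
  -- constants
  set K : ℝ := (k : ℝ) + 1 with hK
  have hKpos : 0 < K := by rw [hK]; positivity
  set s : ℝ := Real.sqrt 2 with hs
  have hss : s * s = 2 := by rw [hs]; exact Real.mul_self_sqrt (by norm_num)
  set t : ℝ := s / K with ht
  set ρ : ℝ := Real.sqrt (2 * (K + 1) / K) with hρ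
  have hρρ : ρ * ρ = 2 * (K + 1) / K := by rw [hρ]; exact Real.mul_self_sqrt (by positivity)
  have hρpos : 0 < ρ := by rw [hρ]; exact Real.sqrt_pos.mpr (by positivity)
  -- product coordinates ℝⁿ × ℝᵏ⁺¹
  obtain ⟨P, hPin, hPsub⟩ := exists_pair_coords (Fin n) (Fin (k + 1))
  -- the simplex √2·eᵢ in the second factor, its centroid m, and the all-ones vector
  set e : Fin (k + 1) → EuclideanSpace ℝ (Fin (k + 1)) := fun i => EuclideanSpace.single i s with he
  set m : EuclideanSpace ℝ (Fin (k + 1)) := (WithLp.equiv 2 (Fin (k + 1) → ℝ)).symm (fun _ => t) with hm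
  set one : EuclideanSpace ℝ (Fin (k + 1)) := (WithLp.equiv 2 (Fin (k + 1) → ℝ)).symm (fun _ => (1 : ℝ)) with hone
  have hm_apply : ∀ j, m j = t := fun j => by rw [hm]; simp
  have hone_apply : ∀ j, one j = 1 := fun j => by rw [hone]; simp
  have he_inner : ∀ i j : Fin (k + 1), inner ℝ (e i) (e j) = if i = j then 2 else 0 := by
    intro i j
    rw [he]; simp only []
    rw [EuclideanSpace.inner_single_left]
    split_ifs with h
    · subst h; simp [hss]
    · simp [h]
  have hone_e : ∀ i, inner ℝ one (e i) = s := by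
    intro i; rw [he]; simp only []; rw [EuclideanSpace.inner_single_right, hone_apply]; simp
  have hone_m : inner ℝ one m = K * t := by
    simp only [EuclideanSpace.inner_eq_star_dotProduct, dotProduct, star_trivial, Pi.star_apply, hm_apply, hone_apply,
      mul_one, Finset.sum_const, Finset.card_univ, Fintype.card_fin, nsmul_eq_mul]
    push_cast; rw [hK]
  have hone_one : inner ℝ one one = K := by
    simp only [EuclideanSpace.inner_eq_star_dotProduct, dotProduct, star_trivial, Pi.star_apply, hone_apply,
      mul_one, Finset.sum_const, Finset.card_univ, Fintype.card_fin, nsmul_eq_mul]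
    push_cast; rw [hK]
  have hem : ∀ i, inner ℝ (e i - m) (e i - m) = 2 * k / K := by
    intro i
    have hme1 : inner ℝ (e i) m = s * t := by
      rw [he]; simp only []; rw [EuclideanSpace.inner_single_left, hm_apply]; simp
    have hme2 : inner ℝ m (e i) = s * t := by rw [real_inner_comm]; exact hme1
    have hmm : inner ℝ m m = K * t ^ 2 := by
      simp only [EuclideanSpace.inner_eq_star_dotProduct, dotProduct, star_trivial, Pi.star_apply, hm_apply,
        Finset.sum_const, Finset.card_univ, Fintype.card_fin, nsmul_eq_mul]
      push_cast; rw [hK]; ring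
    have hee : inner ℝ (e i) (e i) = 2 := by rw [he_inner, if_pos rfl]
    rw [inner_sub_left, inner_sub_right, inner_sub_right, hee, hme1, hme2, hmm, ht]
    field_simp
    rw [hK]; nlinarith [hss]
  -- the configuration in the product space, translated by the centroid: simplex vertices and code centres
  set A0 : Fin (k + 1) → EuclideanSpace ℝ (Fin n ⊕ Fin (k + 1)) := fun i => P 0 (e i - m) with hA0
  set C0 : EuclideanSpace ℝ (Fin n) → EuclideanSpace ℝ (Fin n ⊕ Fin (k + 1)) := fun x => P (ρ • x) 0 with hC0
  set U : EuclideanSpace ℝ (Fin n ⊕ Fin (k + 1)) := P 0 one with hU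
  have hUA : ∀ i, inner ℝ U (A0 i) = 0 := by
    intro i; rw [hU, hA0]; simp only []
    rw [hPin, inner_zero_left, inner_sub_right, hone_e, hone_m, ht]; field_simp; ring
  have hUC : ∀ x, inner ℝ U (C0 x) = 0 := by
    intro x; rw [hU, hC0]; simp only []; rw [hPin, inner_zero_left, inner_zero_right, add_zero]
  have hAA : ∀ i j, i ≠ j → inner ℝ (A0 i - A0 j) (A0 i - A0 j) = 4 := by
    intro i j hij
    rw [hA0]; simp only []; rw [hPsub, hPin, sub_zero, inner_zero_left, zero_add,
      show e i - m - (e j - m) = e i - e j by abel]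
    simp only [inner_sub_left, inner_sub_right, he_inner, if_neg hij, if_neg (Ne.symm hij)]
    norm_num
  have hCA : ∀ x ∈ C, ∀ i, inner ℝ (C0 x - A0 i) (C0 x - A0 i) = 4 := by
    intro x hx i
    have hxx : inner ℝ x x = 1 := by rw [real_inner_self_eq_norm_sq, h1 x hx]; norm_num
    rw [hC0, hA0]; simp only []; rw [hPsub, hPin, sub_zero, zero_sub, inner_neg_left, inner_neg_right, neg_neg,
      hem i, real_inner_smul_left, real_inner_smul_right, hxx, mul_one, hρρ]
    field_simp; rw [hK]; ring
  have hCC : ∀ x ∈ C, ∀ y ∈ C, x ≠ y → (4 : ℝ) ≤ inner ℝ (C0 x - C0 y) (C0 x - C0 y) := by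
    intro x hx y hy hxy
    have hxx : inner ℝ x x = 1 := by rw [real_inner_self_eq_norm_sq, h1 x hx]; norm_num
    have hyy : inner ℝ y y = 1 := by rw [real_inner_self_eq_norm_sq, h1 y hy]; norm_num
    have hb := h2 x hx y hy hxy
    rw [hC0]; simp only []; rw [hPsub, hPin, sub_zero, inner_zero_left, add_zero, ← smul_sub, real_inner_smul_left,
      real_inner_smul_right]
    simp only [inner_sub_left, inner_sub_right, hxx, hyy, real_inner_comm x y]
    have hk2 : (0 : ℝ) < (k : ℝ) + 2 := by positivity
    have hb' : inner ℝ y x ≤ 1 / ((k : ℝ) + 2) := by rw [real_inner_comm]; exact hb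
    have key : ρ * ρ * (2 - 2 * (1 / ((k : ℝ) + 2))) = 4 := by
      rw [hρρ, hK]; field_simp; ring
    nlinarith [hρpos, key, hb']
  -- move the hyperplane Uᗮ of ℝⁿ × ℝᵏ⁺¹ ≅ ℝⁿ⁺ᵏ⁺¹ to ℝⁿ⁺ᵏ by an inner-product-preserving map
  set Φ : EuclideanSpace ℝ (Fin n ⊕ Fin (k + 1)) ≃ₗᵢ[ℝ] EuclideanSpace ℝ (Fin (n + (k + 1))) :=
    LinearIsometryEquiv.piLpCongrLeft 2 ℝ ℝ finSumFinEquiv with hΦ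
  have hUU : inner ℝ U U = K := by
    rw [hU, hPin, inner_zero_left, zero_add, hone_one]
  have hU0 : Φ U ≠ 0 := by
    intro h
    have hn : ‖U‖ = 0 := by rw [← Φ.norm_map U, h, norm_zero]
    have : inner ℝ U U = 0 := by rw [norm_eq_zero.mp hn, inner_zero_left]
    rw [hUU] at this; exact absurd this (ne_of_gt hKpos)
  haveI : Fact (finrank ℝ (EuclideanSpace ℝ (Fin (n + (k + 1)))) = (n + k) + 1) :=
    ⟨by rw [finrank_euclideanSpace_fin]; omega⟩
  have hV : finrank ℝ (ℝ ∙ Φ U)ᗮ = n + k := Submodule.finrank_orthogonal_span_singleton hU0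
  obtain ⟨f, hf⟩ := Config.exists_inner_preserving (ℝ ∙ Φ U)ᗮ hV
  have hmem : ∀ v, inner ℝ U v = 0 → Φ v ∈ (ℝ ∙ Φ U)ᗮ := by
    intro v hv
    rw [Submodule.mem_orthogonal_singleton_iff_inner_right, LinearIsometryEquiv.inner_map_map, hv]
  -- distances are preserved along F = f ∘ Φ on the hyperplane
  set F : EuclideanSpace ℝ (Fin n ⊕ Fin (k + 1)) → EuclideanSpace ℝ (Fin (n + k)) := fun v => f (Φ v) with hF
  have hdist : ∀ v w, inner ℝ U v = 0 → inner ℝ U w = 0 →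
      inner ℝ (F v - F w) (F v - F w) = inner ℝ (v - w) (v - w) := by
    intro v w hv hw
    rw [hF]; simp only []
    simp only [inner_sub_left, inner_sub_right]
    rw [hf _ (hmem v hv) _ (hmem v hv), hf _ (hmem v hv) _ (hmem w hw), hf _ (hmem w hw) _ (hmem v hv),
      hf _ (hmem w hw) _ (hmem w hw)]
    simp only [LinearIsometryEquiv.inner_map_map]
  have hnorm : ∀ v w : EuclideanSpace ℝ (Fin (n + k)), ∀ r : ℝ, 0 ≤ r → inner ℝ (v - w) (v - w) = r ^ 2 →
      ‖v - w‖ = r := by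
    intro v w r hr h
    rw [real_inner_self_eq_norm_sq] at h
    nlinarith [norm_nonneg (v - w)]
  -- the answer
  refine ⟨fun i => F (A0 i), ?_, C.image (fun x => F (C0 x)), ?_, ?_, ?_⟩
  · intro i j hij
    apply hnorm _ _ 2 (by norm_num)
    rw [hdist _ _ (hUA i) (hUA j), hAA i j hij]; norm_num
  · refine card_image_of_injOn ?_
    intro x hx y hy hexy
    by_contra hne
    have h4 := hCC x hx y hy hne
    rw [← hdist _ _ (hUC x) (hUC y)] at h4
    have hexy' : F (C0 x) = F (C0 y) := hexy
    have : F (C0 x) - F (C0 y) = 0 := by rw [hexy', sub_self]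
    rw [this, inner_zero_left] at h4
    norm_num at h4
  · intro c hc i
    obtain ⟨x, hx, rfl⟩ := mem_image.mp hc
    apply hnorm _ _ 2 (by norm_num)
    rw [hdist _ _ (hUC x) (hUA i), hCA x hx i]; norm_num
  · intro c hc c' hc' hne
    obtain ⟨x, hx, rfl⟩ := mem_image.mp hc
    obtain ⟨y, hy, rfl⟩ := mem_image.mp hc'
    have hxy : x ≠ y := fun h => hne (by rw [h])
    have h4 := hCC x hx y hy hxy
    rw [← hdist _ _ (hUC x) (hUC y), real_inner_self_eq_norm_sq] at h4
    nlinarith [norm_nonneg (F (C0 x) - F (C0 y))]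

/-- **Two-sided dictionary.** If `N` is the largest size of a code of unit vectors of `ℝⁿ` with pairwise inner products
`≤ 1/(k+2)`, then `N` is the largest number of pairwise non-overlapping unit spheres of `ℝⁿ⁺ᵏ` that can touch `k + 1`
mutually touching unit spheres. [cite: ConwaySloane1999, Ch. 14 Theorem 1] -/
theorem touching_isGreatest_of_code_isGreatest {n k N : ℕ}
    (h : IsGreatest {M : ℕ | ∃ C : Finset (EuclideanSpace ℝ (Fin n)), C.card = M ∧ (∀ x ∈ C, ‖x‖ = 1) ∧
        (∀ x ∈ C, ∀ y ∈ C, x ≠ y → inner ℝ x y ≤ 1 / ((k : ℝ) + 2))} N) :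
    IsGreatest {M : ℕ | ∃ a : Fin (k + 1) → EuclideanSpace ℝ (Fin (n + k)), (∀ i j, i ≠ j → ‖a i - a j‖ = 2) ∧
        ∃ S : Finset (EuclideanSpace ℝ (Fin (n + k))), S.card = M ∧ (∀ c ∈ S, ∀ i, ‖c - a i‖ = 2) ∧
          (∀ c ∈ S, ∀ c' ∈ S, c ≠ c' → 2 ≤ ‖c - c'‖)} N := by
  obtain ⟨⟨C, hC, h1, h2⟩, hN⟩ := h
  refine ⟨?_, ?_⟩
  · obtain ⟨a, ha, S, hS, hS1, hS2⟩ := exists_touching_of_code C h1 h2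
    exact ⟨a, ha, S, hS.trans hC, hS1, hS2⟩
  · rintro M ⟨a, ha, S, rfl, hS1, hS2⟩
    exact touching_le_of_code_bound (fun C' h1' h2' => hN ⟨C', rfl, h1', h2'⟩) a ha S hS1 hS2

/-! ## SPLAG Ch. 14 Example 2 as exact kernel values in `ℝ⁸` -/

/-- **`ℝ⁸`, two touching unit spheres: exactly `56`** further pairwise non-overlapping unit spheres can touch both
(`A(7, arccos 1/3) = 56`, `Config.Dim7Card56.code_isGreatest`; the `E₈` number). [cite: ConwaySloane1999, Ch. 14 Example 2] -/
theorem touching_two_dim8_isGreatest :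
    IsGreatest {M : ℕ | ∃ a : Fin 2 → EuclideanSpace ℝ (Fin 8), (∀ i j, i ≠ j → ‖a i - a j‖ = 2) ∧
        ∃ S : Finset (EuclideanSpace ℝ (Fin 8)), S.card = M ∧ (∀ c ∈ S, ∀ i, ‖c - a i‖ = 2) ∧
          (∀ c ∈ S, ∀ c' ∈ S, c ≠ c' → 2 ≤ ‖c - c'‖)} 56 := by
  have h := Config.Dim7Card56.code_isGreatest
  refine touching_isGreatest_of_code_isGreatest (n := 7) (k := 1) ?_
  convert h using 4; norm_num

/-- **`ℝ⁸`, three mutually touching unit spheres: exactly `27`** further pairwise non-overlapping unit spheres can touch all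
three (`A(6, arccos 1/4) = 27`, `Config.Dim6Card27.code_isGreatest`; the `E₈` number). [cite: ConwaySloane1999, Ch. 14 Example 2] -/
theorem touching_three_dim8_isGreatest :
    IsGreatest {M : ℕ | ∃ a : Fin 3 → EuclideanSpace ℝ (Fin 8), (∀ i j, i ≠ j → ‖a i - a j‖ = 2) ∧
        ∃ S : Finset (EuclideanSpace ℝ (Fin 8)), S.card = M ∧ (∀ c ∈ S, ∀ i, ‖c - a i‖ = 2) ∧
          (∀ c ∈ S, ∀ c' ∈ S, c ≠ c' → 2 ≤ ‖c - c'‖)} 27 := by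
  have h := Config.Dim6Card27.code_isGreatest
  refine touching_isGreatest_of_code_isGreatest (n := 6) (k := 2) ?_
  convert h using 4; norm_num

/-- **`ℝ⁸`, four mutually touching unit spheres: exactly `16`** further pairwise non-overlapping unit spheres can touch all
four (`A(5, arccos 1/5) = 16`, `Config.Dim5Card16.code_isGreatest`; the `E₈` number). [cite: ConwaySloane1999, Ch. 14 Example 2] -/
theorem touching_four_dim8_isGreatest :
    IsGreatest {M : ℕ | ∃ a : Fin 4 → EuclideanSpace ℝ (Fin 8), (∀ i j, i ≠ j → ‖a i - a j‖ = 2) ∧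
        ∃ S : Finset (EuclideanSpace ℝ (Fin 8)), S.card = M ∧ (∀ c ∈ S, ∀ i, ‖c - a i‖ = 2) ∧
          (∀ c ∈ S, ∀ c' ∈ S, c ≠ c' → 2 ≤ ‖c - c'‖)} 16 := by
  have h := Config.Dim5Card16.code_isGreatest
  refine touching_isGreatest_of_code_isGreatest (n := 5) (k := 3) ?_
  convert h using 4; norm_num


/-- **`ℝ⁸`, five mutually touching unit spheres: exactly `10`** further pairwise non-overlapping unit spheres can touch all
five (`A(4, arccos 1/6) = 10`: the three-point row `S3T11` and the Petersen code, through
`code_dim4_eq_10_of_mem_Icc_83_400`; the `E₈` number `(4, 10, 1/6)`). [cite: ConwaySloane1999, Ch. 14 Example 2] -/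
theorem touching_five_dim8_isGreatest :
    IsGreatest {M : ℕ | ∃ a : Fin 5 → EuclideanSpace ℝ (Fin 8), (∀ i j, i ≠ j → ‖a i - a j‖ = 2) ∧
        ∃ S : Finset (EuclideanSpace ℝ (Fin 8)), S.card = M ∧ (∀ c ∈ S, ∀ i, ‖c - a i‖ = 2) ∧
          (∀ c ∈ S, ∀ c' ∈ S, c ≠ c' → 2 ≤ ‖c - c'‖)} 10 := by
  have h := code_dim4_eq_10_of_mem_Icc_83_400 (s := 1 / 6) le_rfl (by norm_num)
  have e : (1 : ℝ) / (((4 : ℕ) : ℝ) + 2) = 1 / 6 := by norm_num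
  refine touching_isGreatest_of_code_isGreatest (n := 4) (k := 4) ⟨?_, ?_⟩
  · obtain ⟨C, hc, h1, h2⟩ := h.1
    exact ⟨C, hc, h1, fun x hx y hy hxy => (h2 x hx y hy hxy).trans_eq e.symm⟩
  · rintro M ⟨C, rfl, h1, h2⟩
    exact h.2 C h1 (fun x hx y hy hxy => (h2 x hx y hy hxy).trans_eq e)

end Summit.Ventures.PackingBounds.SphericalCodes
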